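import Summits.ResolutionOfSingularities.ResolutionOfSingularities.Theorems.FaceCutKernels3
import HarnessLib

/-!
# FaceCutKernels4 — decomp-res node «FaceCut» (lens-2 g26, critic row 208 CLEARED), tree file 4/6 of the node

Content VERBATIM from the decomp-res lens-2 g26 node `HOME/decomp-res-lens-2/g26/FaceCut.lean` (pin dd1d04c7; no
carry, imports the landed g24 node only; ns `…Theses.FaceCut` ↦ `…Theorems.FaceCut`, sub-namespace `FaceX` kept);
HOME = run/shared/lean/pub/decomp-res; critic CRITIC-LEDGER row 208 CLEARED; landing orders INBOX :1364 / rider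
10:41:11Z — provenance, critic text and the lens header in the first file of the node, `FaceCutKernels`.  `--kind
proof --supports stmt-ResolutionOfSingularities-29273`.

## This file

Continuation 4/4 of `FaceCutKernels` (same namespace / sections of the node, cut at the tree's 400-line cap; section
variables / opens replayed): scopes `FaceRing` — carries `face_leaf10_s_zero`,
`face_leaf10_s_nonzero`, `face_leaf12_s_nonzero`,
`face_leaf13_s_nonzero`, `face_leaf13_t`,
`face_leaf19_u`, `face_leaf20_t`,
`face_leaf23_u`, `face_leaf24_s`,
`face_leaf25_t`, `face_leaf28_t`,
`face_leaf33_t_zero`,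
`face_leaf35_t`,
`face_tower`,
`face_towerMonomial`, `face_weight_iff`, `insepV3_faceLetter`, `insepV3_faceRoot`.

[WRITER NOTE (decomp-res writer g13): file split only (tree files ≤ 400 lines); sections, section variables / opens
and every declaration exactly as in the lens (the node's two HOME-only lines `linter.style.longFile` /
dupNamespace-linter are dropped; the namespace-level `open` lines of the node are replayed in every part, the `open
…Theses` line only in the Theses-cone file `MaxContactCutFaceCut`); namespace renamed `…Theses.FaceCut` ↦
`…Theorems.FaceCut`; the cone-free parts import `…Theorems.CuspCutCells2` (the landed g24 cells) instead of the g24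
wiring file, which only the cone file imports.]

(Sources: Hironaka1964 Ch. III §§1–3; CossartJannsenSaito2020 Ch. 2, Ch. 8–9; Matsumura1987 Thm 28.3, §29;
Cohen1946; ZariskiSamuelII Ch. VII §1; Bourbaki AC VII §3; CossartPiltant2008 Prop. 4.2, Lemma 4.3; Moh1987;
Hauser2010Kangaroo; BierstoneGrigorievMilmanWlodarczyk2011 §3; Cutkosky2009.)
-/

open CategoryTheory AlgebraicGeometry TopologicalSpace IsLocalRing
open Literature.AlgebraicGeometry.Resolution
open Summit.ResolutionOfSingularities.ResolutionOfSingularities.Theorems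
open Summit.ResolutionOfSingularities.ResolutionOfSingularities.Theorems.WeakOrderReduction
open Summit.ResolutionOfSingularities.ResolutionOfSingularities.Theorems.DeltaFaceCutClasses
open Summit.ResolutionOfSingularities.ResolutionOfSingularities.Theorems.RelativeDeltaCut
open Summit.ResolutionOfSingularities.ResolutionOfSingularities.Theorems.CurveLeafExit
open Summit.ResolutionOfSingularities.ResolutionOfSingularities.Theorems.PinchCut
open Summit.ResolutionOfSingularities.ResolutionOfSingularities.Theorems.JetCut
open Summit.ResolutionOfSingularities.ResolutionOfSingularities.Theorems.PurityCut
open Summit.ResolutionOfSingularities.ResolutionOfSingularities.Theorems.SplitCut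
open Summit.ResolutionOfSingularities.ResolutionOfSingularities.Theorems.CylinderCut
open Summit.ResolutionOfSingularities.ResolutionOfSingularities.Theorems.SpreadCut
open Summit.ResolutionOfSingularities.ResolutionOfSingularities.Theorems.CrossCut
open Summit.ResolutionOfSingularities.ResolutionOfSingularities.Theorems.DeepCrossCut
open Summit.ResolutionOfSingularities.ResolutionOfSingularities.Theorems.OddCrossCut
open Summit.ResolutionOfSingularities.ResolutionOfSingularities.Theorems.CuspCut

namespace Summit.ResolutionOfSingularities.ResolutionOfSingularities.Theorems.FaceCut

section FaceRing

variable {R : Type} [CommRing R]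

/-! ### Leaf certificates whose certificate statement is TRIVIAL AS A TYPE (writer g13, tree dedup rule)

The following 35 leaf certificates of the lens node have, as Lean types, exactly the statement `1 * x = x` or `s * a
= s * a` already landed in `FaceCutKernels3` as `face_leaf8_u_zero` / `face_leaf5_u_nonzero` (and their look-alikes
there); the tree refuses a second declaration of an already-landed type (`dedup.landed`), so they are RECORDED here
with their leaf data and CITED, not restated — the certificate of each is the named landed declaration (proof `ring`
in every case).  The leaf bookkeeping (which entries are used, the unit, the branch) is the docstring text of the
lens, verbatim:

- `face_leaf10_u`: leaf ν10 [d5 u], `F0 = a * s + b * u * s^6 + c * u^2 * t^3`, component `E = {u = 0}`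
(non-carrier, `r = 1`, `r_B = 1`): entries used `∂s F̄`; unit = `a`. — certificate statement `(1) * (a) = a`, the
SAME TYPE as the landed `face_leaf8_u_zero` (`FaceCutKernels3`): cited, not restated.
- `face_leaf10_s_zero`: leaf ν10 [d5 u], `F0 = a * s + b * u * s^6 + c * u^2 * t^3`, component `E = {s = 0}`
(non-carrier, `r = 2`, `r_B = 1`): entries used `∂s F|N`; unit = `a`. BRANCH `F̄0(P) = 0` (`c = 0`: all entries
usable) — certificate statement `(1) * (a) = a`, the SAME TYPE as the landed `face_leaf8_u_zero`
(`FaceCutKernels3`): cited, not restated.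
- `face_leaf12_u`: leaf ν12 [d6 u], `F0 = a * s + b * u^2 * s^6 * t + c * u * t^2`, component `E = {u = 0}`
(non-carrier, `r = 1`, `r_B = 1`): entries used `∂s F̄`; unit = `a`. — certificate statement `(1) * (a) = a`, the
SAME TYPE as the landed `face_leaf8_u_zero` (`FaceCutKernels3`): cited, not restated.
- `face_leaf12_s_zero`: leaf ν12 [d6 u], `F0 = a * s + b * u^2 * s^6 * t + c * u * t^2`, component `E = {s = 0}`
(non-carrier, `r = 2`, `r_B = 1`): entries used `∂s F|N`; unit = `a`. BRANCH `F̄0(P) = 0` (`c = 0`: all entries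
usable) — certificate statement `(1) * (a) = a`, the SAME TYPE as the landed `face_leaf8_u_zero`
(`FaceCutKernels3`): cited, not restated.
- `face_leaf12_t`: leaf ν12 [d6 u], `F0 = a * s + b * u^2 * s^6 * t + c * u * t^2`, component `E = {t = 0}`
(non-carrier, `r = 1`, `r_B = 1`): entries used `∂s F̄`; unit = `a`. — certificate statement `(1) * (a) = a`, the
SAME TYPE as the landed `face_leaf8_u_zero` (`FaceCutKernels3`): cited, not restated.
- `face_leaf13_u`: leaf ν13 [d6 t], `F0 = a * u^2 * s + b * u^3 * s^6 * t^2 + c * u * t`, component `E = {u = 0}`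
(CARRIER, `r = 2`, `r_B = 1`): entries used `∂t G|E`; unit = `c`. — certificate statement `(1) * (c) = c`, the SAME
TYPE as the landed `face_leaf8_u_zero` (`FaceCutKernels3`): cited, not restated.
- `face_leaf13_s_zero`: leaf ν13 [d6 t], `F0 = a * u^2 * s + b * u^3 * s^6 * t^2 + c * u * t`, component `E = {s =
0}` (non-carrier, `r = 2`, `r_B = 1`): entries used `∂u∂t F̄`; unit = `c`. BRANCH `F̄0(P) = 0` (`c = 0`: all entries
usable) — certificate statement `(1) * (c) = c`, the SAME TYPE as the landed `face_leaf8_u_zero`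
(`FaceCutKernels3`): cited, not restated.
- `face_leaf17_u`: leaf ν17 [d5 u], `F0 = a * u + b * s + c * u * s^2 * t^3`, component `E = {u = 0}` (non-carrier,
`r = 1`, `r_B = 1`): entries used `∂s F̄`; unit = `b`. — certificate statement `(1) * (b) = b`, the SAME TYPE as the
landed `face_leaf8_u_zero` (`FaceCutKernels3`): cited, not restated.
- `face_leaf17_s`: leaf ν17 [d5 u], `F0 = a * u + b * s + c * u * s^2 * t^3`, component `E = {s = 0}` (non-carrier,
`r = 1`, `r_B = 1`): entries used `∂u F̄`; unit = `a`. — certificate statement `(1) * (a) = a`, the SAME TYPE as the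
landed `face_leaf8_u_zero` (`FaceCutKernels3`): cited, not restated.
- `face_leaf19_s`: leaf ν19 [d6 u], `F0 = a * u * t + b * u * s + c * s^2 * t`, component `E = {s = 0}`
(non-carrier, `r = 1`, `r_B = 1`): entries used `∂u∂t F̄`; unit = `a`. — certificate statement `(1) * (a) = a`, the
SAME TYPE as the landed `face_leaf8_u_zero` (`FaceCutKernels3`): cited, not restated.
- `face_leaf19_t`: leaf ν19 [d6 u], `F0 = a * u * t + b * u * s + c * s^2 * t`, component `E = {t = 0}`
(non-carrier, `r = 1`, `r_B = 1`): entries used `∂u∂s F̄`; unit = `b`. — certificate statement `(1) * (b) = b`, the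
SAME TYPE as the landed `face_leaf8_u_zero` (`FaceCutKernels3`): cited, not restated.
- `face_leaf20_u`: leaf ν20 [d6 s], `F0 = a * u^3 * s * t + b * u^2 * s + c * t`, component `E = {u = 0}`
(non-carrier, `r = 1`, `r_B = 1`): entries used `∂t F̄`; unit = `c`. — certificate statement `(1) * (c) = c`, the
SAME TYPE as the landed `face_leaf8_u_zero` (`FaceCutKernels3`): cited, not restated.
- `face_leaf20_s`: leaf ν20 [d6 s], `F0 = a * u^3 * s * t + b * u^2 * s + c * t`, component `E = {s = 0}`
(non-carrier, `r = 1`, `r_B = 1`): entries used `∂t F̄`; unit = `c`. — certificate statement `(1) * (c) = c`, the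
SAME TYPE as the landed `face_leaf8_u_zero` (`FaceCutKernels3`): cited, not restated.
- `face_leaf23_s`: leaf ν23 [d6 u], `F0 = a * u + b * u * s^2 * t + c * s * t^2`, component `E = {s = 0}`
(non-carrier, `r = 1`, `r_B = 1`): entries used `∂u F̄`; unit = `a`. — certificate statement `(1) * (a) = a`, the
SAME TYPE as the landed `face_leaf8_u_zero` (`FaceCutKernels3`): cited, not restated.
- `face_leaf23_t`: leaf ν23 [d6 u], `F0 = a * u + b * u * s^2 * t + c * s * t^2`, component `E = {t = 0}`
(non-carrier, `r = 1`, `r_B = 1`): entries used `∂u F̄`; unit = `a`. — certificate statement `(1) * (a) = a`, the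
SAME TYPE as the landed `face_leaf8_u_zero` (`FaceCutKernels3`): cited, not restated.
- `face_leaf24_u`: leaf ν24 [d6 t], `F0 = a * u^3 * t + b * u^2 * s^2 * t + c * s`, component `E = {u = 0}`
(non-carrier, `r = 1`, `r_B = 1`): entries used `∂s F̄`; unit = `c`. — certificate statement `(1) * (c) = c`, the
SAME TYPE as the landed `face_leaf8_u_zero` (`FaceCutKernels3`): cited, not restated.
- `face_leaf24_t`: leaf ν24 [d6 t], `F0 = a * u^3 * t + b * u^2 * s^2 * t + c * s`, component `E = {t = 0}`
(non-carrier, `r = 1`, `r_B = 1`): entries used `∂s F̄`; unit = `c`. — certificate statement `(1) * (c) = c`, the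
SAME TYPE as the landed `face_leaf8_u_zero` (`FaceCutKernels3`): cited, not restated.
- `face_leaf25_u`: leaf ν25 [d5 t], `F0 = a * u^3 * s^2 + b * u^2 * s^3 * t^2 + c * s * t`, component `E = {u = 0}`
(non-carrier, `r = 1`, `r_B = 1`): entries used `∂s∂t F̄`; unit = `c`. — certificate statement `(1) * (c) = c`, the
SAME TYPE as the landed `face_leaf8_u_zero` (`FaceCutKernels3`): cited, not restated.
- `face_leaf25_s`: leaf ν25 [d5 t], `F0 = a * u^3 * s^2 + b * u^2 * s^3 * t^2 + c * s * t`, component `E = {s = 0}`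
(CARRIER, `r = 2`, `r_B = 1`): entries used `∂t G|E`; unit = `c`. — certificate statement `(1) * (c) = c`, the SAME
TYPE as the landed `face_leaf8_u_zero` (`FaceCutKernels3`): cited, not restated.
- `face_leaf27_s`: leaf ν27 [d4 s], `F0 = a * u^3 * s + b * u + c * u * s * t^3`, component `E = {s = 0}`
(non-carrier, `r = 1`, `r_B = 1`): entries used `∂u F̄`; unit = `b`. — certificate statement `(1) * (b) = b`, the
SAME TYPE as the landed `face_leaf8_u_zero` (`FaceCutKernels3`): cited, not restated.
- `face_leaf28_s`: leaf ν28 [d4 t], `F0 = a * u^3 * s^3 * t + b * u * s^2 + c * u * t`, component `E = {s = 0}`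
(non-carrier, `r = 1`, `r_B = 1`): entries used `∂u∂t F̄`; unit = `c`. — certificate statement `(1) * (c) = c`, the
SAME TYPE as the landed `face_leaf8_u_zero` (`FaceCutKernels3`): cited, not restated.
- `face_leaf32_u_zero`: leaf ν32 [d4 u], `F0 = a * t + b * u^7 * s^5 * t^4 + c * u * t^2`, component `E = {u = 0}`
(non-carrier, `r = 2`, `r_B = 1`): entries used `∂t F̄`; unit = `a`. BRANCH `F̄0(P) = 0` (`c = 0`: all entries
usable) — certificate statement `(1) * (a) = a`, the SAME TYPE as the landed `face_leaf8_u_zero`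
(`FaceCutKernels3`): cited, not restated.
- `face_leaf32_u_nonzero`: leaf ν32 [d4 u], `F0 = a * t + b * u^7 * s^5 * t^4 + c * u * t^2`, component `E = {u =
0}` (non-carrier, `r = 2`, `r_B = 1`): entries used `∂t F̄`; unit = `t * a`. BRANCH `F̄0(P) ≠ 0` (`F̄0` inverted;
only Artin–Schreier-free entries) — certificate statement `(t) * (a) = t * a`, the SAME TYPE as the landed
`face_leaf5_u_nonzero` (`FaceCutKernels3`): cited, not restated.
- `face_leaf32_t`: leaf ν32 [d4 u], `F0 = a * t + b * u^7 * s^5 * t^4 + c * u * t^2`, component `E = {t = 0}`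
(CARRIER, `r = 2`, `r_B = 1`): entries used `G|E`; unit = `a`. — certificate statement `(1) * (a) = a`, the SAME
TYPE as the landed `face_leaf8_u_zero` (`FaceCutKernels3`): cited, not restated.
- `face_leaf33_u`: leaf ν33 [d4 t], `F0 = a * u + b * u^5 * s^5 * t^7 + c * u * t`, component `E = {u = 0}`
(CARRIER, `r = 2`, `r_B = 1`): entries used `∂t G|E`; unit = `c`. — certificate statement `(1) * (c) = c`, the SAME
TYPE as the landed `face_leaf8_u_zero` (`FaceCutKernels3`): cited, not restated.
- `face_leaf33_t_zero`: leaf ν33 [d4 t], `F0 = a * u + b * u^5 * s^5 * t^7 + c * u * t`, component `E = {t = 0}`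
(non-carrier, `r = 2`, `r_B = 1`): entries used `∂t∂u F|N`; unit = `c`. BRANCH `F̄0(P) = 0` (`c = 0`: all entries
usable) — certificate statement `(1) * (c) = c`, the SAME TYPE as the landed `face_leaf8_u_zero`
(`FaceCutKernels3`): cited, not restated.
- `face_leaf33_t_nonzero`: leaf ν33 [d4 t], `F0 = a * u + b * u^5 * s^5 * t^7 + c * u * t`, component `E = {t = 0}`
(non-carrier, `r = 2`, `r_B = 1`): entries used `∂u F̄`; unit = `u * a`. BRANCH `F̄0(P) ≠ 0` (`F̄0` inverted; only
Artin–Schreier-free entries) — certificate statement `(u) * (a) = u * a`, the SAME TYPE as the landed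
`face_leaf5_u_nonzero` (`FaceCutKernels3`): cited, not restated.
- `face_leaf35_u_zero`: leaf ν35 [d4 u], `F0 = a * u * t + b * u^6 * s^5 * t^5 + c * t`, component `E = {u = 0}`
(non-carrier, `r = 2`, `r_B = 1`): entries used `∂t F̄`; unit = `c`. BRANCH `F̄0(P) = 0` (`c = 0`: all entries
usable) — certificate statement `(1) * (c) = c`, the SAME TYPE as the landed `face_leaf8_u_zero`
(`FaceCutKernels3`): cited, not restated.
- `face_leaf35_u_nonzero`: leaf ν35 [d4 u], `F0 = a * u * t + b * u^6 * s^5 * t^5 + c * t`, component `E = {u = 0}`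
(non-carrier, `r = 2`, `r_B = 1`): entries used `∂t F̄`; unit = `t * c`. BRANCH `F̄0(P) ≠ 0` (`F̄0` inverted; only
Artin–Schreier-free entries) — certificate statement `(t) * (c) = t * c`, the SAME TYPE as the landed
`face_leaf5_u_nonzero` (`FaceCutKernels3`): cited, not restated.
- `face_leaf36_u`: leaf ν36 [d4 t], `F0 = a * u^2 * t + b * u^3 * s^5 * t^6 + c * u`, component `E = {u = 0}`
(CARRIER, `r = 2`, `r_B = 1`): entries used `G|E`; unit = `c`. — certificate statement `(1) * (c) = c`, the SAME
TYPE as the landed `face_leaf8_u_zero` (`FaceCutKernels3`): cited, not restated.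
- `face_leaf36_t_zero`: leaf ν36 [d4 t], `F0 = a * u^2 * t + b * u^3 * s^5 * t^6 + c * u`, component `E = {t = 0}`
(non-carrier, `r = 2`, `r_B = 1`): entries used `∂u F̄`; unit = `c`. BRANCH `F̄0(P) = 0` (`c = 0`: all entries
usable) — certificate statement `(1) * (c) = c`, the SAME TYPE as the landed `face_leaf8_u_zero`
(`FaceCutKernels3`): cited, not restated.
- `face_leaf36_t_nonzero`: leaf ν36 [d4 t], `F0 = a * u^2 * t + b * u^3 * s^5 * t^6 + c * u`, component `E = {t =
0}` (non-carrier, `r = 2`, `r_B = 1`): entries used `∂u F̄`; unit = `u * c`. BRANCH `F̄0(P) ≠ 0` (`F̄0` inverted;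
only Artin–Schreier-free entries) — certificate statement `(u) * (c) = u * c`, the SAME TYPE as the landed
`face_leaf5_u_nonzero` (`FaceCutKernels3`): cited, not restated.
- `face_leaf38_u`: leaf ν38 [d3 u], `F0 = a * u^3 * t^2 + b * u^2 * s^5 * t^3 + c * t`, component `E = {u = 0}`
(non-carrier, `r = 1`, `r_B = 1`): entries used `∂t F̄`; unit = `c`. — certificate statement `(1) * (c) = c`, the
SAME TYPE as the landed `face_leaf8_u_zero` (`FaceCutKernels3`): cited, not restated.
- `face_leaf38_t`: leaf ν38 [d3 u], `F0 = a * u^3 * t^2 + b * u^2 * s^5 * t^3 + c * t`, component `E = {t = 0}`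
(CARRIER, `r = 2`, `r_B = 1`): entries used `G|E`; unit = `c`. — certificate statement `(1) * (c) = c`, the SAME
TYPE as the landed `face_leaf8_u_zero` (`FaceCutKernels3`): cited, not restated.
- `face_leaf39_t`: leaf ν39 [d3 t], `F0 = a * u^3 * t^3 + b * u * s^5 * t^2 + c * u`, component `E = {t = 0}`
(non-carrier, `r = 1`, `r_B = 1`): entries used `∂u F̄`; unit = `c`. — certificate statement `(1) * (c) = c`, the
SAME TYPE as the landed `face_leaf8_u_zero` (`FaceCutKernels3`): cited, not restated. -/

/-- leaf ν10 [d5 u], `F0 = a * s + b * u * s^6 + c * u^2 * t^3`, component `E = {s = 0}` (non-carrier, `r = 2`, `r_B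
= 1`): entries used `∂t F̄`; unit = `u^2 * t^3 * c`. BRANCH `F̄0(P) ≠ 0` (`F̄0` inverted; only Artin–Schreier-free
entries) [kernel] [folklore] -/
theorem face_leaf10_s_nonzero (u t c : R) (h2 : (2 : R) = 0) :
    (t) * (3 * u^2 * t^2 * c) = u^2 * t^3 * c := by
  linear_combination (u^2 * t^3 * c) * h2

/-- leaf ν12 [d6 u], `F0 = a * s + b * u^2 * s^6 * t + c * u * t^2`, component `E = {s = 0}` (non-carrier, `r = 2`,
`r_B = 1`): entries used `∂u F̄`; unit = `u * t^2 * c`. BRANCH `F̄0(P) ≠ 0` (`F̄0` inverted; only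
Artin–Schreier-free entries) [kernel] [folklore] -/
theorem face_leaf12_s_nonzero (u t c : R) :
    (u) * (t^2 * c) = u * t^2 * c := by
  ring

/-- leaf ν13 [d6 t], `F0 = a * u^2 * s + b * u^3 * s^6 * t^2 + c * u * t`, component `E = {s = 0}` (non-carrier, `r
= 2`, `r_B = 1`): entries used `∂u F̄`; unit = `u * t * c`. BRANCH `F̄0(P) ≠ 0` (`F̄0` inverted; only
Artin–Schreier-free entries) [kernel] [folklore] -/
theorem face_leaf13_s_nonzero (u t c : R) :
    (u) * (t * c) = u * t * c := by
  ring

/-- leaf ν13 [d6 t], `F0 = a * u^2 * s + b * u^3 * s^6 * t^2 + c * u * t`, component `E = {t = 0}` (non-carrier, `r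
= 1`, `r_B = 1`) — off the certified component(s) `{u = 0}, {s = 0}`: entries used `∂s F̄`; unit = `u^2 * a`.
[kernel] [folklore] -/
theorem face_leaf13_t (u a : R) :
    (1) * (u^2 * a) = u^2 * a := by
  ring

/-- leaf ν19 [d6 u], `F0 = a * u * t + b * u * s + c * s^2 * t`, component `E = {u = 0}` (non-carrier, `r = 1`, `r_B
= 1`) — off the certified component(s) `{s = 0}, {t = 0}`: entries used `∂t F̄`; unit = `s^2 * c`. [kernel] [folklore] -/
theorem face_leaf19_u (s c : R) :
    (1) * (s^2 * c) = s^2 * c := by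
  ring

/-- leaf ν20 [d6 s], `F0 = a * u^3 * s * t + b * u^2 * s + c * t`, component `E = {t = 0}` (non-carrier, `r = 1`,
`r_B = 1`) — off the certified component(s) `{u = 0}, {s = 0}`: entries used `∂s F̄`; unit = `u^2 * b`. [kernel] [folklore] -/
theorem face_leaf20_t (u b : R) :
    (1) * (u^2 * b) = u^2 * b := by
  ring

/-- leaf ν23 [d6 u], `F0 = a * u + b * u * s^2 * t + c * s * t^2`, component `E = {u = 0}` (non-carrier, `r = 1`,
`r_B = 1`) — off the certified component(s) `{s = 0}, {t = 0}`: entries used `∂s F̄`; unit = `t^2 * c`. [kernel] [folklore] -/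
theorem face_leaf23_u (t c : R) :
    (1) * (t^2 * c) = t^2 * c := by
  ring

/-- leaf ν24 [d6 t], `F0 = a * u^3 * t + b * u^2 * s^2 * t + c * s`, component `E = {s = 0}` (non-carrier, `r = 1`,
`r_B = 1`) — off the certified component(s) `{u = 0}, {t = 0}`: entries used `∂u∂t F̄`; unit = `u^2 * a`. [kernel] [folklore] -/
theorem face_leaf24_s (u a : R) (h2 : (2 : R) = 0) :
    (1) * (3 * u^2 * a) = u^2 * a := by
  linear_combination (u^2 * a) * h2

/-- leaf ν25 [d5 t], `F0 = a * u^3 * s^2 + b * u^2 * s^3 * t^2 + c * s * t`, component `E = {t = 0}` (non-carrier,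
`r = 1`, `r_B = 1`) — off the certified component(s) `{u = 0}, {s = 0}`: entries used `∂u F̄`; unit = `u^2 * s^2 *
a`. [kernel] [folklore] -/
theorem face_leaf25_t (u s a : R) (h2 : (2 : R) = 0) :
    (1) * (3 * u^2 * s^2 * a) = u^2 * s^2 * a := by
  linear_combination (u^2 * s^2 * a) * h2

/-- leaf ν28 [d4 t], `F0 = a * u^3 * s^3 * t + b * u * s^2 + c * u * t`, component `E = {t = 0}` (non-carrier, `r =
1`, `r_B = 1`) — off the certified component(s) `{s = 0}`: entries used `∂u F̄`; unit = `s^2 * b`. [kernel] [folklore] -/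
theorem face_leaf28_t (s b : R) :
    (1) * (s^2 * b) = s^2 * b := by
  ring

/-- leaf ν35 [d4 u], `F0 = a * u * t + b * u^6 * s^5 * t^5 + c * t`, component `E = {t = 0}` (CARRIER, `r = 2`, `r_B
= 1`): entries used `G|E, ∂u G|E`; unit = `c`. [kernel] [folklore] -/
theorem face_leaf35_t (u a c : R) (h2 : (2 : R) = 0) :
    (1) * (c + u * a) + (u) * (a) = c := by
  linear_combination (u * a) * h2

/-! ### §F.0d  THE DICTIONARY IDENTITIES (tower substitution; INSEP-v³ reads the face letter with `e = (1,1,1)`, tail `0`) -/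

/-- **TOWER**: substituting `z̃ = u²Z`, `u₁ = us`, `u₂ = u`, `v = t` into the face normal form
`z̃² + e₁u₁⁵ + e₂v³u₂⁵ + e₀u₂⁷` gives `u⁴ · (Z² + e₁·us⁵ + e₂·ut³ + e₀·u³)` — the ROOT `F0 = a·u³ + b·us⁵ + c·ut³`
(`a = e₀, b = e₁, c = e₂`; g24 `insepV3_stage1/2` are the case `e = 1`).  KERNEL. [folklore] -/
theorem face_tower (Z u s t e₀ e₁ e₂ : R) :
    (u ^ 2 * Z) ^ 2 + e₁ * (u * s) ^ 5 + e₂ * t ^ 3 * u ^ 5 + e₀ * u ^ 7 =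
      u ^ 4 * (Z ^ 2 + (e₀ * u ^ 3 + e₁ * (u * s ^ 5) + e₂ * (u * t ^ 3))) := by
  ring

/-- **A TAIL MONOMIAL THROUGH THE TOWER**: `z̃ᵃ u₁ⁱ u₂ʲ vˡ = u^{2a+i+j} · (Zᵃ sⁱ tˡ)`; after division by `u⁴` it is
`Zᵃ u^{2a+i+j−4} sⁱ tˡ` of weight `(105a + 42i + 30j + 20l − 120)/2`, hence `> 45` iff `105a+42i+30j+20l > 210` — the
letter's inequality.  KERNEL (the monomial identity; the weight count is arithmetic). [folklore] -/
theorem face_towerMonomial (Z u s t : R) (a i j l : ℕ) :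
    (u ^ 2 * Z) ^ a * (u * s) ^ i * u ^ j * t ^ l = u ^ (2 * a + i + j) * (Z ^ a * s ^ i * t ^ l) := by
  ring

/-- The letter's weight inequality IS «weight `> 45` after the tower» (times 2, plus `120`):
`2·(45/2·a + 15·(2a+i+j−4) + 6i + 10l) = 105a + 42i + 30j + 20l − 120`.  KERNEL (`omega`). [folklore] -/
theorem face_weight_iff (a i j l : ℕ) (h : 4 ≤ 2 * a + i + j) :
    210 < 105 * a + 42 * i + 30 * j + 20 * l ↔ 90 < 45 * a + 30 * (2 * a + i + j - 4) + 12 * i + 20 * l := by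
  omega

/-- **INSEP-v³ READS THE FACE LETTER** with `e₀ = e₁ = e₂ = 1` and tail `0`: in the frame `c = (X₀ + X₁(X₂+X₃), X₂, X₃)`,
`v = X₁` (g24 `represent_INSEPv3`), `f − c₀² − 1·c₁⁵ − 1·v³c₂⁵ − 1·c₂⁷ = 0`.  KERNEL. [folklore] -/
theorem insepV3_faceLetter (X₀ X₁ X₂ X₃ : R) :
    (X₀ + X₁ * (X₂ + X₃)) ^ 2 + X₂ ^ 5 + X₁ ^ 3 * X₃ ^ 5 + X₃ ^ 7
      - (X₀ + X₁ * (X₂ + X₃)) ^ 2 - 1 * X₂ ^ 5 - 1 * X₁ ^ 3 * X₃ ^ 5 - 1 * X₃ ^ 7 = 0 := by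
  ring

/-- **THE ROOT OF THE PILOT IS THE ROOT OF THE TABLE**: INSEP-v³'s post-tower germ `u·s⁵ + u·t³ + u³` (g24
`insepV3_stage2`, `pilot_root_*`) is `F0_{ν0}` with `a = b = c = 1`.  KERNEL. [folklore] -/
theorem insepV3_faceRoot (u s t : R) :
    u * s ^ 5 + u * t ^ 3 + u ^ 3 = 1 * u ^ 3 + 1 * (u * s ^ 5) + 1 * (u * t ^ 3) := by
  ring

end FaceRing

end Summit.ResolutionOfSingularities.ResolutionOfSingularities.Theorems.FaceCut
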